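import Summits.CriticalPhenomena.SAWScalingLimit.Theorems.SAWDefectDecoherenceObservableToSLERCarvedReductionSqueezeInnerApproxPrep
import Summits.CriticalPhenomena.SAWScalingLimit.Theorems.SAWDefectDecoherenceObservableToSLERCarvedReductionSqueezeInnerTrace
import Summits.CriticalPhenomena.SAWScalingLimit.Theorems.SAWDefectDecoherenceObservableToSLERCarvedReductionSqueezeInnerLift
import Summits.CriticalPhenomena.SAWScalingLimit.Theorems.SAWDefectDecoherenceObservableToSLERCarvedReductionSqueezeInnerDomain
import HarnessLib

/-!
# The inner approximant of the limit bulk: the repaired contract `InnerApproximant2`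
# (piece (K4), assembly, of stub 5a4″ `stub_carvedReduction_squeezeSolid`)

Piece of stub 5a4″ `stub_carvedReduction_squeezeSolid`
(`TwoPieceAdmRestrictionLimit → MovingCarvingSqueezeP FatAnchoredClassZeroSolid`) of the line
`bridge-gate-renewal` (r11) of the crux `SAWDefectDecoherence.ObservableToSLER`
(stmt-CriticalPhenomena-14005; twin T-A `stub_carvedReduction_squeezeGeometry` of
stmt-CriticalPhenomena-10472).  THE INNER APPROXIMANT CONTRACT (v2): given the target Dobrushin
domain `D` (marks `a < b`), the translation `τ`, the two-piece flat super-domain `E` (flat radius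
`ρE` at the gate points `E.pt i`, chordal uniformizer `φ`), the limit carving `K k` (compact convex
sets inside `B(D.pt i - τ, rs/2)`), the bulk `Ω` = component of `b₀` in `(D - τ) ∖ ⋃ K` with
`Ω ⊆ E`, windows of `E` inside `Ω`, no long fingers at radius `rs`, `Ωᶜ` connected, and a
parameter window `s` with (H1) near parameters spatially `η/3`-near, (H2) `2 rs`-near boundary
points parameter-near: for every window-ball radius `ρw > 0` there are radii `r₁, R₁` such that
for all `r' ≤ r₁`, `R' ≥ R₁`, `δ₀, θ > 0` a Dobrushin domain `M'` WITH THE MARKS OF `D` exists which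
is a hull subdomain of `E` inside `Ω`, flat at the windows, with closure inside a compact of `Ω`
but for the `ρw`-window balls, hull between `A = cl(ℍ ∖ φ⁻¹ Ω)` and
`thickHull A δ₀ ∪ {im ≤ θ, r' ≤ |z| ≤ R'}`, and whose boundary loop is `η`-close to
`D.boundary t - τ` PARAMETER BY PARAMETER (clause (C2)), marked points included.

Assembly: translate (`stub_carvedReduction_translate`), bulk uniformizer
(`stub_carvedReduction_bulk`), trace inputs (`stub_carvedReduction_traceInputs`), the boundary
trace (`stub_carvedReduction_boundaryTrace`), the lift (`stub_carvedReduction_liftExtension`,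
multiplied by the orientation `σ`), the inner domain (`stub_carvedReduction_innerDomain`, with
`θmax` from the uniform continuity of `ψ̄` at scale `η/3` and `ρM = min ρE ρw`), and the tracking
estimate (`loop_tracks`).

* `innerApproximant_core` — the statement for `τ = 0` with the bulk as a named set;
* `stub_carvedReduction_innerApproximant` — the registered contract `InnerApproximant2`.

Sources: G. F. Lawler, O. Schramm, W. Werner, J. Amer. Math. Soc. 16 (2003) §2 (hulls);
Ch. Pommerenke, Boundary Behaviour of Conformal Maps (1992), Thms. 2.1, 2.6, §2.4.
-/

noncomputable section
open scoped Topology Real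
open Filter Set Metric Function Bornology
open UpperHalfPlane (upperHalfPlaneSet)
open Literature.Probability.RandomPlanarGeometry

namespace Summit.CriticalPhenomena.SAWScalingLimit.Theorems.ObservableToSLER.Squeeze

/-! ### The contract for the untranslated domain -/

/-- **The inner approximant, untranslated form.**  See the module docstring: the statement of
`InnerApproximant2` for `τ = 0`, with the bulk `Ω` (the component of `b₀` in `D ∖ ⋃ K`) as a
named set and (C2) in the form `dist (M'.boundary t) (D.boundary t) ≤ η`. -/
theorem innerApproximant_core (D E : DobrushinDomain) (b₀ : ℂ)
    (φ : ConformalEquiv upperHalfPlaneSet E.carrier) (m : ℕ) (K : Fin m → Set ℂ)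
    (ρE rs η s ρw : ℝ) (Ω : Set ℂ) (hΩdef : Ω = connectedComponentIn (D.carrier \ ⋃ k, K k) b₀)
    (hφ : E.IsChordalUniformizing φ) (hρE : 0 < ρE) (hrs : 0 < rs) (hη : 0 < η) (hrsη : rs ≤ η / 6)
    (hηd : η ≤ dist (D.pt 0) (D.pt 1)) (hs : 0 < s) (hab : D.mark 0 + s < D.mark 1 - s)
    (hba : D.mark 1 + s < D.mark 0 + 1 - s)
    (H1 : ∀ i : Fin 2, ∀ t : ℝ, |t - D.mark i| ≤ s → dist (D.boundary t) (D.pt i) < η / 3)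
    (H2 : ∀ i : Fin 2, ∀ t : ℝ, dist (D.boundary t) (D.pt i) ≤ 2 * rs →
      ∃ n : ℤ, |t - D.mark i - n| < s)
    (hflat : ∀ i : Fin 2,
      E.carrier ∩ ball (E.pt i) ρE = {z : ℂ | (E.pt i).im < z.im} ∩ ball (E.pt i) ρE)
    (hK : ∀ k, IsCompact (K k) ∧ Convex ℝ (K k))
    (hKball : ∀ k, K k ⊆ ⋃ i : Fin 2, ball (D.pt i) (rs / 2))
    (hEpt : ∀ i : Fin 2, E.pt i ∈ ball (D.pt i) (rs / 2))
    (hwin : ∀ i : Fin 2, {z : ℂ | (E.pt i).im < z.im} ∩ ball (E.pt i) ρE ⊆ Ω)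
    (hΩE : Ω ⊆ E.carrier) (hEΩ : (E.carrier \ Ω).Nonempty)
    (hfing : D.carrier \ (⋃ i : Fin 2, closedBall (D.pt i) rs) ⊆ Ω) (hΩc : IsConnected Ωᶜ)
    (hρw : 0 < ρw) :
    ∃ r₁ > (0 : ℝ), ∃ R₁ : ℝ, ∀ (r' R' δ₀ θ : ℝ), 0 < r' → r' ≤ r₁ → R₁ ≤ R' → 0 < δ₀ → 0 < θ →
      ∃ M' : DobrushinDomain, M'.mark = D.mark ∧ E.IsHullSubdomain M' ∧ M'.carrier ⊆ Ω ∧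
        (∃ ρ' > (0 : ℝ), ∀ i : Fin 2,
          M'.carrier ∩ ball (E.pt i) ρ' = {z : ℂ | (E.pt i).im < z.im} ∩ ball (E.pt i) ρ') ∧
        (∃ Kc : Set ℂ, IsCompact Kc ∧ Kc ⊆ Ω ∧
          closure M'.carrier ⊆ Kc ∪ ⋃ i : Fin 2, ball (E.pt i) ρw) ∧
        closure (upperHalfPlaneSet \ φ.symm '' Ω) ⊆ φ.pullbackHull M' ∧
        φ.pullbackHull M' ⊆ thickHull (closure (upperHalfPlaneSet \ φ.symm '' Ω)) δ₀ ∪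
          {z : ℂ | z.im ≤ θ ∧ r' ≤ ‖z‖ ∧ ‖z‖ ≤ R'} ∧
        (∀ t : ℝ, dist (M'.boundary t) (D.boundary t) ≤ η) ∧
        dist (M'.pt 0) (D.pt 0) ≤ η ∧ dist (M'.pt 1) (D.pt 1) ≤ η := by
  -- (1) the bulk and its disc uniformizer
  have hb₀ : b₀ ∈ D.carrier \ ⋃ k, K k := by
    by_contra h
    have h0 := hwin 0 (window_point (E.pt 0) (half_pos hρE) (half_lt_self hρE))
    rw [hΩdef, connectedComponentIn_eq_empty h] at h0
    exact notMem_empty _ h0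
  have hΩc' : IsConnected (connectedComponentIn (D.carrier \ ⋃ k, K k) b₀)ᶜ := by
    rw [← hΩdef]; exact hΩc
  have hbulk := stub_carvedReduction_bulk D m K b₀ hK hb₀ hΩc'
  rw [← hΩdef] at hbulk
  obtain ⟨hΩo, hΩb, -, hΩpc, hlc, ψ, hΦc, -, htend⟩ := hbulk
  -- (2) the inputs of the trace theorem
  obtain ⟨hfar, hfar2, hinj, ha0, ha1, hb0, hb1, hcover⟩ :=
    stub_carvedReduction_traceInputs D m K b₀ Ω ψ rs η s hΩdef hΩo hΩb hΩpc hlc hΦc htend hrs hrsη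
      hs hab hba H1 H2 (fun k => (hK k).1.isClosed) hKball hfing
  -- (3) gate preimages and near balls
  obtain ⟨ζ₀, hζ₀, hζ₀E⟩ := gate_preimage ψ E hΩo hΦc htend hρE hwin hΩE 0
  obtain ⟨ζ₁, hζ₁, hζ₁E⟩ := gate_preimage ψ E hΩo hΦc htend hρE hwin hΩE 1
  set Φ := extendFrom (ball 0 1) ψ with hΦdef
  have hdisj : Disjoint (ball (D.pt 0) (η / 3)) (ball (D.pt 1) (η / 3)) :=
    ball_disjoint_ball (by linarith)
  have hg₀ : Φ ζ₀ ∈ ball (D.pt 0) (η / 3) := by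
    rw [hζ₀E]; exact mem_ball.2 ((mem_ball.1 (hEpt 0)).trans_le (by linarith))
  have hg₁ : Φ ζ₁ ∈ ball (D.pt 1) (η / 3) := by
    rw [hζ₁E]; exact mem_ball.2 ((mem_ball.1 (hEpt 1)).trans_le (by linarith))
  have hζ₀far : Φ ζ₀ ∉ D.boundary ''
      (Icc (D.mark 0 + s) (D.mark 1 - s) ∪ Icc (D.mark 1 + s) (D.mark 0 + 1 - s)) := by
    rintro ⟨t, ht, hteq⟩
    have h1 := hfar2 t ht 0
    rw [hteq, hζ₀E] at h1
    linarith [mem_ball.1 (hEpt 0)]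
  have hζ₁far : Φ ζ₁ ∉ D.boundary ''
      (Icc (D.mark 0 + s) (D.mark 1 - s) ∪ Icc (D.mark 1 + s) (D.mark 0 + 1 - s)) := by
    rintro ⟨t, ht, hteq⟩
    have h1 := hfar2 t ht 1
    rw [hteq, hζ₁E] at h1
    linarith [mem_ball.1 (hEpt 1)]
  -- (4) the boundary trace and the lift
  obtain ⟨σ, c, Θ₀, hσ, hcζ₀, hcP, hcM, hmP, hmM, hfarΦ, hc₁, hc₂, ⟨q, hq₁, hq₂, hqζ₁⟩, hgap₁,
      hgap₀⟩ :=
    stub_carvedReduction_boundaryTrace Φ D.boundary (D.mark 0) (D.mark 1) s (ball (D.pt 0) (η / 3))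
      (ball (D.pt 1) (η / 3)) ζ₀ ζ₁ (hΦc.mono sphere_subset_closedBall) D.continuous_boundary hs
      hab hba isOpen_ball isOpen_ball hdisj hζ₀ hζ₁ hg₀ hg₁ hζ₀far hζ₁far hfar hinj ha0 ha1 hb0 hb1
      hcover
  obtain ⟨Θℓ, hΘc, hΘm, hΘper, hΘeq, hΘb, hΘa, hΘwb, hΘwa⟩ :=
    stub_carvedReduction_liftExtension Θ₀ (D.mark 0) (D.mark 1) s c q hs hab hba hcP hcM hmP hmM
      hc₁ hq₁ hq₂ hc₂
  have hσ0 : σ ≠ 0 := by rcases hσ with rfl | rfl <;> norm_num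
  set Θ : ℝ → ℝ := fun t => σ * Θℓ t with hΘdef
  have hΘcont : Continuous Θ := by
    show Continuous fun t => σ * Θℓ t
    fun_prop
  have hΘinj : Injective Θ := by
    intro x y hxy
    have h : σ * Θℓ x = σ * Θℓ y := hxy
    exact hΘm.injective (mul_left_cancel₀ hσ0 h)
  have hΘper' : ∀ t, Θ (t + 1) = Θ t + σ := fun t => by
    show σ * Θℓ (t + 1) = σ * Θℓ t + σ
    rw [hΘper t]; ring
  have hΘ0 : Θℓ (D.mark 0) = c := by
    have := hΘper (D.mark 0)
    linarith [hΘa]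
  have hζ : ∀ i, ‖(![ζ₀, ζ₁] : Fin 2 → ℂ) i‖ = 1 ∧
      extendFrom (ball 0 1) ψ ((![ζ₀, ζ₁] : Fin 2 → ℂ) i) = E.pt i ∧
      circleMap 0 1 (2 * π * Θ (D.mark i)) = (![ζ₀, ζ₁] : Fin 2 → ℂ) i := by
    refine Fin.forall_fin_two.2 ⟨⟨hζ₀, hζ₀E, ?_⟩, ⟨hζ₁, hζ₁E, ?_⟩⟩
    · show circleMap 0 1 (2 * π * (σ * Θℓ (D.mark 0))) = ζ₀
      rw [hΘ0]; exact hcζ₀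
    · show circleMap 0 1 (2 * π * (σ * Θℓ (D.mark 1))) = ζ₁
      rw [hΘb]; exact hqζ₁
  -- (5) uniform continuity of `ψ̄` at scale `η/3`, the window scale, the inner domain
  obtain ⟨ω, hω, hωΦ⟩ : ∃ ω > (0 : ℝ), ∀ x ∈ closedBall (0 : ℂ) 1, ∀ y ∈ closedBall (0 : ℂ) 1,
      dist x y < ω → dist (Φ x) (Φ y) < η / 3 :=
    Metric.uniformContinuousOn_iff.1 ((isCompact_closedBall 0 1).uniformContinuousOn_of_continuous
      hΦc) (η / 3) (by positivity)
  set θmax : ℝ := min (ω / 2) (1 / 2) with hθmaxdef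
  have hθmax : 0 < θmax := by positivity
  have hθω : θmax ≤ ω / 2 := min_le_left _ _
  have hθhalf : θmax ≤ 1 / 2 := min_le_right _ _
  set ρM : ℝ := min ρE ρw with hρMdef
  have hρM : 0 < ρM := lt_min hρE hρw
  have hρME : ρM ≤ ρE := min_le_left _ _
  have hρMw : ρM ≤ ρw := min_le_right _ _
  obtain ⟨r₁, hr₁, R₁, hdom⟩ := stub_carvedReduction_innerDomain Ω ψ E φ ρE ρM θmax σ Θ D.mark
    ![ζ₀, ζ₁] hΩo hΩb hΩpc hΦc htend hφ hρE hρM hρME hθmax hflat hwin hΩE hEΩ hσ hΘcont hΘinj hΘper'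
    D.strictMono_mark D.mark_mem hζ
  refine ⟨r₁, hr₁, R₁, fun r' R' δ₀ θ hr' hr'₁ hR₁' hδ₀ hθ => ?_⟩
  obtain ⟨M', r, hrb, hMmk, hMbd, hHull, hMΩ, hMflat, ⟨Kc, hKc, hKcΩ, hKcM⟩, hlow, hup, -, -, -⟩ :=
    hdom r' R' δ₀ θ hr' hr'₁ hR₁' hδ₀ hθ
  -- (6) the tracking estimate (C2)
  have htrack : ∀ t, dist (Φ (circleMap 0 1 (2 * π * (σ * Θℓ t)))) (D.boundary t) < 2 * η / 3 :=
    loop_tracks (Θ₀ := Θ₀) (c := c) D.periodic_boundary hσ hη (H1 0) (H1 1) hfarΦ hgap₁ hgap₀ hΘper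
      hΘeq hΘwb hΘwa
  have hC2 : ∀ t, dist (M'.boundary t) (D.boundary t) ≤ η := by
    intro t
    rw [hMbd t]
    set ξ : ℂ := circleMap 0 1 (2 * π * Θ t) with hξdef
    have hξ1 : ‖ξ‖ = 1 := norm_circleMap_two_pi _
    have hrξ := hrb ξ
    have hr0 : 0 ≤ r ξ := by linarith [hrξ.1]
    have hdist : dist (((r ξ : ℝ) : ℂ) * ξ) ξ < ω := by
      rw [dist_eq_norm, show ((r ξ : ℝ) : ℂ) * ξ - ξ = ((r ξ - 1 : ℝ) : ℂ) * ξ by push_cast; ring,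
        norm_mul, Complex.norm_real, Real.norm_eq_abs, hξ1, mul_one,
        abs_of_nonpos (by linarith [hrξ.2])]
      linarith [hrξ.1]
    have hin1 : ((r ξ : ℝ) : ℂ) * ξ ∈ closedBall (0 : ℂ) 1 := by
      rw [mem_closedBall_zero_iff, norm_mul, Complex.norm_real, Real.norm_eq_abs, hξ1, mul_one,
        abs_of_nonneg hr0]
      exact hrξ.2
    have hin2 : ξ ∈ closedBall (0 : ℂ) 1 := mem_closedBall_zero_iff.2 hξ1.le
    have h1 := hωΦ _ hin1 _ hin2 hdist
    have h2 : dist (Φ ξ) (D.boundary t) < 2 * η / 3 := htrack t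
    calc dist (Φ (((r ξ : ℝ) : ℂ) * ξ)) (D.boundary t)
        ≤ dist (Φ (((r ξ : ℝ) : ℂ) * ξ)) (Φ ξ) + dist (Φ ξ) (D.boundary t) := dist_triangle _ _ _
      _ ≤ η / 3 + 2 * η / 3 := add_le_add h1.le h2.le
      _ = η := by ring
  -- (7) outputs
  refine ⟨M', hMmk, hHull, hMΩ, ⟨ρM / 4, by positivity, hMflat⟩,
    ⟨Kc, hKc, hKcΩ, hKcM.trans (union_subset_union_right _
      (iUnion_mono fun i => ball_subset_ball hρMw))⟩, hlow, hup, hC2, ?_, ?_⟩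
  · rw [hHull.2.1]
    exact ((mem_ball.1 (hEpt 0)).trans_le (by linarith)).le
  · rw [hHull.2.2.1]
    exact ((mem_ball.1 (hEpt 1)).trans_le (by linarith)).le

/-! ### The registered contract -/

/-- **Registered sub-goal `stub_carvedReduction_innerApproximant`** (crux item
stmt-CriticalPhenomena-14005, stub 5a4″ `stub_carvedReduction_squeezeSolid`, piece (K4) THE INNER
APPROXIMANT CONTRACT `InnerApproximant2`): see the module docstring.  Reduction to
`innerApproximant_core` for the translate `D - τ` (`stub_carvedReduction_translate`: same marks,
loop `D.boundary t - τ`, marked points `D.pt i - τ`). [cite: LawlerSchrammWerner2003Restriction, §2 p. 8 (hulls and fillings)] -/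
theorem stub_carvedReduction_innerApproximant :
    ∀ (D E : DobrushinDomain) (τ b₀ : ℂ) (φ : ConformalEquiv upperHalfPlaneSet E.carrier) (m : ℕ)
      (K : Fin m → Set ℂ) (ρE rs η s : ℝ),
      E.IsChordalUniformizing φ → 0 < ρE → 0 < rs → 0 < η → rs ≤ η / 6 →
      η ≤ dist (D.pt 0) (D.pt 1) →
      0 < s → D.mark 0 + s < D.mark 1 - s → D.mark 1 + s < D.mark 0 + 1 - s →
      (∀ i : Fin 2, ∀ t : ℝ, |t - D.mark i| ≤ s → dist (D.boundary t) (D.pt i) < η / 3) →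
      (∀ i : Fin 2, ∀ t : ℝ, dist (D.boundary t) (D.pt i) ≤ 2 * rs →
        ∃ n : ℤ, |t - D.mark i - n| < s) →
      (∀ i : Fin 2,
        E.carrier ∩ ball (E.pt i) ρE = {z : ℂ | (E.pt i).im < z.im} ∩ ball (E.pt i) ρE) →
      (∀ k, IsCompact (K k) ∧ Convex ℝ (K k)) →
      (∀ k, K k ⊆ ⋃ i : Fin 2, ball (D.pt i - τ) (rs / 2)) →
      (∀ i : Fin 2, E.pt i ∈ ball (D.pt i - τ) (rs / 2)) →
      let Dτ : Set ℂ := (fun z => z - τ) '' D.carrier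
      let Ω : Set ℂ := connectedComponentIn (Dτ \ ⋃ k, K k) b₀
      let A : Set ℂ := closure (upperHalfPlaneSet \ φ.symm '' Ω)
      (∀ i : Fin 2, {z : ℂ | (E.pt i).im < z.im} ∩ ball (E.pt i) ρE ⊆ Ω) → Ω ⊆ E.carrier →
      (E.carrier \ Ω).Nonempty →
      Dτ \ (⋃ i : Fin 2, closedBall (D.pt i - τ) rs) ⊆ Ω → IsConnected Ωᶜ →
      ∀ ρw > (0 : ℝ), ∃ r₁ > (0 : ℝ), ∃ R₁ : ℝ, ∀ (r' R' δ₀ θ : ℝ), 0 < r' → r' ≤ r₁ → R₁ ≤ R' →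
        0 < δ₀ → 0 < θ →
        ∃ M' : DobrushinDomain, M'.mark = D.mark ∧ E.IsHullSubdomain M' ∧ M'.carrier ⊆ Ω ∧
          (∃ ρ' > (0 : ℝ), ∀ i : Fin 2,
            M'.carrier ∩ ball (E.pt i) ρ' = {z : ℂ | (E.pt i).im < z.im} ∩ ball (E.pt i) ρ') ∧
          (∃ Kc : Set ℂ, IsCompact Kc ∧ Kc ⊆ Ω ∧
            closure M'.carrier ⊆ Kc ∪ ⋃ i : Fin 2, ball (E.pt i) ρw) ∧
          A ⊆ φ.pullbackHull M' ∧
          φ.pullbackHull M' ⊆ thickHull A δ₀ ∪ {z : ℂ | z.im ≤ θ ∧ r' ≤ ‖z‖ ∧ ‖z‖ ≤ R'} ∧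
          (∀ t : ℝ, dist (M'.boundary t + τ) (D.boundary t) ≤ η) ∧
          dist (M'.pt 0 + τ) (D.pt 0) ≤ η ∧ dist (M'.pt 1 + τ) (D.pt 1) ≤ η := by
  intro D E τ b₀ φ m K ρE rs η s hφ hρE hrs hη hrsη hηd hs hab hba H1 H2 hflat hK hKball hEpt Dτ Ω A
    hwin hΩE hEΩ hfing hΩc ρw hρw
  obtain ⟨Dd, hcar, hmark, hbd, hpt⟩ := stub_carvedReduction_translate D τ
  -- the data of the contract in terms of the translate `Dd`
  have hd : ∀ x y : ℂ, dist (x + τ) y = dist x (y - τ) := fun x y => by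
    rw [dist_eq_norm, dist_eq_norm]; congr 1; ring
  have hηd' : η ≤ dist (Dd.pt 0) (Dd.pt 1) := by rw [hpt, hpt, dist_sub_right]; exact hηd
  have hab' : Dd.mark 0 + s < Dd.mark 1 - s := by rw [hmark]; exact hab
  have hba' : Dd.mark 1 + s < Dd.mark 0 + 1 - s := by rw [hmark]; exact hba
  have H1' : ∀ i : Fin 2, ∀ t : ℝ, |t - Dd.mark i| ≤ s →
      dist (Dd.boundary t) (Dd.pt i) < η / 3 := by
    intro i t ht
    rw [hbd, hpt, dist_sub_right]
    rw [hmark] at ht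
    exact H1 i t ht
  have H2' : ∀ i : Fin 2, ∀ t : ℝ, dist (Dd.boundary t) (Dd.pt i) ≤ 2 * rs →
      ∃ n : ℤ, |t - Dd.mark i - n| < s := by
    intro i t ht
    rw [hbd, hpt, dist_sub_right] at ht
    rw [hmark]
    exact H2 i t ht
  have hKball' : ∀ k, K k ⊆ ⋃ i : Fin 2, ball (Dd.pt i) (rs / 2) := by
    intro k x hx
    obtain ⟨i, hi⟩ := mem_iUnion.1 (hKball k hx)
    exact mem_iUnion.2 ⟨i, by rw [hpt]; exact hi⟩
  have hEpt' : ∀ i : Fin 2, E.pt i ∈ ball (Dd.pt i) (rs / 2) := fun i => by rw [hpt]; exact hEpt i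
  have hΩdef : Ω = connectedComponentIn (Dd.carrier \ ⋃ k, K k) b₀ := by rw [hcar]
  have hfing' : Dd.carrier \ (⋃ i : Fin 2, closedBall (Dd.pt i) rs) ⊆ Ω := by
    intro x hx
    refine hfing ⟨?_, fun h => hx.2 ?_⟩
    · have h1 := hx.1
      rw [hcar] at h1
      exact h1
    · obtain ⟨i, hi⟩ := mem_iUnion.1 h
      exact mem_iUnion.2 ⟨i, by rw [hpt]; exact hi⟩
  obtain ⟨r₁, hr₁, R₁, hmain⟩ := innerApproximant_core Dd E b₀ φ m K ρE rs η s ρw Ω hΩdef hφ hρE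
    hrs hη hrsη hηd' hs hab' hba' H1' H2' hflat hK hKball' hEpt' hwin hΩE hEΩ hfing' hΩc hρw
  refine ⟨r₁, hr₁, R₁, fun r' R' δ₀ θ hr' hr'₁ hR₁' hδ₀ hθ => ?_⟩
  obtain ⟨M', hMmk, hHull, hMΩ, hflat', hKc, hlow, hup, hC2, hp0, hp1⟩ :=
    hmain r' R' δ₀ θ hr' hr'₁ hR₁' hδ₀ hθ
  refine ⟨M', hMmk.trans hmark, hHull, hMΩ, hflat', hKc, hlow, hup, fun t => ?_, ?_, ?_⟩
  · rw [hd, ← hbd]; exact hC2 t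
  · rw [hd, ← hpt]; exact hp0
  · rw [hd, ← hpt]; exact hp1

end Summit.CriticalPhenomena.SAWScalingLimit.Theorems.ObservableToSLER.Squeeze

end
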